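import Mathlib
import Summits.ValiantsHypothesis.ValiantsHypothesis.Theorems.ElementaryWordLengthWordLengthQPStubInversionCost

/-!
# Crux `WordLengthQP` (stmt-ValiantsHypothesis-6623), line `positive-monoid-exits` —
THEOREM M₃: every product of three variables has exit number ≤ 17 (lead c6)

The multivariate companion of THEOREM U (`…UnivariateBoundedExits`): for any index type `σ` and any
`a b c : σ`, the transvection `E₀₂(x_a x_b x_c)` is computed by a valid real word with at most `17`
exits.  Mechanism (parabolic submodel with the PALINDROMIC walk `x_c x_b | x_a x_b x_c`, found by the
lead's submodel solver and verified here by the kernel): with the positive adjacent words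

  `Q₁ = x₂(1) x₁(x_c) y₁(x_b)`,
  `R  = x₁(x_c) x₂(1) y₁(x_b) x₁(x_a) y₁(x_b) x₁(x_c) x₂(1)`,
  `Q₂ = x₁(x_a) x₂(1) y₁(x_b) x₁(x_c)`

(`x₁ = E₀₁, x₂ = E₁₂, y₁ = E₁₀`) one has `R = Q₁ · E₀₂(x_a x_b x_c + 2 x_c) · Q₂`
(`tripleProduct_sandwich`), i.e. `b(E₀₂(x_a x_b x_c + 2x_c)) ≤ 3`; the junk `2 x_c` is one far letter.
So `E₀₂(x_a x_b x_c) = Q₁⁻¹ R Q₂⁻¹ E₀₂(-2x_c)` with `Q₁⁻¹, Q₂⁻¹` by the 8-exit inversion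
`stub_inversionCost`: `8 + 0 + 8 + 1 = 17` exits (registered calibration stub
`stub_tripleProductExits`).  The kit table "`κ(x₁x₂x₃) ≥ 5`" (j020269) was a length-≤ 10 artefact; by
substitution the same holds for any three nonnegative linear forms.  No definitions. [folklore]
-/

-- `Summit.ValiantsHypothesis.ValiantsHypothesis.…` is the tree's mandated single-conjunct layout
-- (Sub = Summit), so the duplicated namespace component is intended.
set_option linter.dupNamespace false

noncomputable section

namespace Summit.ValiantsHypothesis.ValiantsHypothesis.Cruxes.WordLengthQP.PositiveMonoidExits

open Matrix

/-- **The palindromic sandwich for a triple product**: `R = Q₁ · E₀₂(x_a x_b x_c + 2x_c) · Q₂` with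
`Q₁ = x₂(1) x₁(x_c) y₁(x_b)`, `R = x₁(x_c) x₂(1) y₁(x_b) x₁(x_a) y₁(x_b) x₁(x_c) x₂(1)`,
`Q₂ = x₁(x_a) x₂(1) y₁(x_b) x₁(x_c)` — all letters positive adjacent. [folklore] -/
theorem tripleProduct_sandwich {σ : Type} (a b c : σ) :
    Matrix.transvection (0 : Fin 3) 1 (MvPolynomial.X c : MvPolynomial σ ℝ) *
      (Matrix.transvection (1 : Fin 3) 2 (1 : MvPolynomial σ ℝ) *
      (Matrix.transvection (1 : Fin 3) 0 (MvPolynomial.X b : MvPolynomial σ ℝ) *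
      (Matrix.transvection (0 : Fin 3) 1 (MvPolynomial.X a : MvPolynomial σ ℝ) *
      (Matrix.transvection (1 : Fin 3) 0 (MvPolynomial.X b : MvPolynomial σ ℝ) *
      (Matrix.transvection (0 : Fin 3) 1 (MvPolynomial.X c : MvPolynomial σ ℝ) *
      Matrix.transvection (1 : Fin 3) 2 (1 : MvPolynomial σ ℝ)))))) =
    (Matrix.transvection (1 : Fin 3) 2 (1 : MvPolynomial σ ℝ) *
      (Matrix.transvection (0 : Fin 3) 1 (MvPolynomial.X c : MvPolynomial σ ℝ) *
      Matrix.transvection (1 : Fin 3) 0 (MvPolynomial.X b : MvPolynomial σ ℝ))) *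
    Matrix.transvection (0 : Fin 3) 2
      (MvPolynomial.X a * MvPolynomial.X b * MvPolynomial.X c + 2 * MvPolynomial.X c : MvPolynomial σ ℝ) *
    (Matrix.transvection (0 : Fin 3) 1 (MvPolynomial.X a : MvPolynomial σ ℝ) *
      (Matrix.transvection (1 : Fin 3) 2 (1 : MvPolynomial σ ℝ) *
      (Matrix.transvection (1 : Fin 3) 0 (MvPolynomial.X b : MvPolynomial σ ℝ) *
      Matrix.transvection (0 : Fin 3) 1 (MvPolynomial.X c : MvPolynomial σ ℝ)))) := by
  apply Matrix.ext
  intro i j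
  fin_cases i <;> fin_cases j <;>
    simp [Matrix.transvection, Matrix.mul_apply, Fin.sum_univ_three, Matrix.single, Matrix.of_apply,
      Matrix.one_apply] <;> ring

/-- The exit filter of a list of positive adjacent letters is empty. [folklore] -/
theorem tripleProduct_filter_nil {σ : Type} (w : List (Fin 3 × Fin 3 × ℝ × Option σ))
    (hw : ∀ l ∈ w, 0 < l.2.2.1 ∧ (l.1.val + 1 = l.2.1.val ∨ l.2.1.val + 1 = l.1.val)) :
    (w.filter (fun l => !decide (0 < l.2.2.1 ∧
      (l.1.val + 1 = l.2.1.val ∨ l.2.1.val + 1 = l.1.val)))).length = 0 := by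
  rw [List.length_eq_zero_iff, List.filter_eq_nil_iff]
  intro l hl
  have h := hw l hl
  simp [h]

/-- **THEOREM M₃ (registered calibration stub `stub_tripleProductExits`, lead c6): every product of
three variables has a valid real word with at most 17 exits** — `Q₁⁻¹ R Q₂⁻¹ E₀₂(-2x_c)` with the
palindromic sandwich `tripleProduct_sandwich`, the 8-exit inversions of `stub_inversionCost`, and one
far letter for the linear junk.  (`a, b, c` need not be distinct; `σ` arbitrary.) [folklore] -/
theorem stub_tripleProductExits {σ : Type} (a b c : σ) :
    ∃ w : List (Fin 3 × Fin 3 × ℝ × Option σ), (∀ l ∈ w, l.1 ≠ l.2.1) ∧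
      (w.map (fun l => Matrix.transvection l.1 l.2.1
        (MvPolynomial.C l.2.2.1 * l.2.2.2.elim 1 MvPolynomial.X))).prod =
        Matrix.transvection (0 : Fin 3) 2
          (MvPolynomial.X a * MvPolynomial.X b * MvPolynomial.X c : MvPolynomial σ ℝ) ∧
      (w.filter (fun l => !decide (0 < l.2.2.1 ∧
          (l.1.val + 1 = l.2.1.val ∨ l.2.1.val + 1 = l.1.val)))).length ≤ 17 := by
  -- the three positive words
  let Q₁ : List (Fin 3 × Fin 3 × ℝ × Option σ) :=
    [((1 : Fin 3), (2 : Fin 3), (1 : ℝ), (none : Option σ)), (0, 1, 1, some c), (1, 0, 1, some b)]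
  let R : List (Fin 3 × Fin 3 × ℝ × Option σ) :=
    [((0 : Fin 3), (1 : Fin 3), (1 : ℝ), some c), (1, 2, 1, none), (1, 0, 1, some b), (0, 1, 1, some a),
      (1, 0, 1, some b), (0, 1, 1, some c), (1, 2, 1, none)]
  let Q₂ : List (Fin 3 × Fin 3 × ℝ × Option σ) :=
    [((0 : Fin 3), (1 : Fin 3), (1 : ℝ), some a), (1, 2, 1, none), (1, 0, 1, some b), (0, 1, 1, some c)]
  have hQ₁ : ∀ l ∈ Q₁, 0 < l.2.2.1 ∧ (l.1.val + 1 = l.2.1.val ∨ l.2.1.val + 1 = l.1.val) := by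
    intro l hl
    simp only [Q₁, List.mem_cons, List.not_mem_nil, or_false] at hl
    rcases hl with rfl | rfl | rfl <;> norm_num
  have hR : ∀ l ∈ R, 0 < l.2.2.1 ∧ (l.1.val + 1 = l.2.1.val ∨ l.2.1.val + 1 = l.1.val) := by
    intro l hl
    simp only [R, List.mem_cons, List.not_mem_nil, or_false] at hl
    rcases hl with rfl | rfl | rfl | rfl | rfl | rfl | rfl <;> norm_num
  have hQ₂ : ∀ l ∈ Q₂, 0 < l.2.2.1 ∧ (l.1.val + 1 = l.2.1.val ∨ l.2.1.val + 1 = l.1.val) := by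
    intro l hl
    simp only [Q₂, List.mem_cons, List.not_mem_nil, or_false] at hl
    rcases hl with rfl | rfl | rfl | rfl <;> norm_num
  have hv : ∀ (w : List (Fin 3 × Fin 3 × ℝ × Option σ)),
      (∀ l ∈ w, 0 < l.2.2.1 ∧ (l.1.val + 1 = l.2.1.val ∨ l.2.1.val + 1 = l.1.val)) →
      ∀ l ∈ w, l.1 ≠ l.2.1 := by
    intro w hw l hl he
    have h2 := (hw l hl).2
    rw [he] at h2
    omega
  obtain ⟨Q₁', hv1', hinv1, hex1, -⟩ := stub_inversionCost Q₁ (hv Q₁ hQ₁)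
  obtain ⟨Q₂', hv2', hinv2, hex2, -⟩ := stub_inversionCost Q₂ (hv Q₂ hQ₂)
  have hinv2' := mul_eq_one_comm.mp hinv2
  -- the sandwich identity for the concrete lists
  have hsand : (R.map (fun l => Matrix.transvection l.1 l.2.1
        (MvPolynomial.C l.2.2.1 * l.2.2.2.elim 1 MvPolynomial.X))).prod =
      (Q₁.map (fun l => Matrix.transvection l.1 l.2.1
        (MvPolynomial.C l.2.2.1 * l.2.2.2.elim 1 MvPolynomial.X))).prod *
      Matrix.transvection (0 : Fin 3) 2
        (MvPolynomial.X a * MvPolynomial.X b * MvPolynomial.X c + 2 * MvPolynomial.X c : MvPolynomial σ ℝ) *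
      (Q₂.map (fun l => Matrix.transvection l.1 l.2.1
        (MvPolynomial.C l.2.2.1 * l.2.2.2.elim 1 MvPolynomial.X))).prod := by
    simp only [Q₁, R, Q₂, List.map_cons, List.map_nil, List.prod_cons, List.prod_nil, mul_one,
      Option.elim_none, Option.elim_some, map_one, one_mul]
    exact tripleProduct_sandwich a b c
  refine ⟨Q₁' ++ R ++ Q₂' ++ [((0 : Fin 3), (2 : Fin 3), (-2 : ℝ), some c)], ?_, ?_, ?_⟩
  · intro l hl
    simp only [List.mem_append, List.mem_singleton] at hl
    rcases hl with ((hl | hl) | hl) | hl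
    · exact hv1' l hl
    · exact hv R hR l hl
    · exact hv2' l hl
    · subst hl; exact (by decide : (0 : Fin 3) ≠ 2)
  · rw [List.map_append, List.map_append, List.map_append, List.prod_append, List.prod_append,
      List.prod_append, hsand]
    simp only [List.map_cons, List.map_nil, List.prod_cons, List.prod_nil, mul_one, Option.elim_some,
      map_neg, map_ofNat]
    have key : ∀ (A A' B B' : Matrix (Fin 3) (Fin 3) (MvPolynomial σ ℝ)) (F G : MvPolynomial σ ℝ),
        A' * A = 1 → B * B' = 1 →
        A' * (A * Matrix.transvection (0 : Fin 3) 2 F * B) * B' * Matrix.transvection (0 : Fin 3) 2 G =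
          Matrix.transvection (0 : Fin 3) 2 (F + G) := by
      intro A A' B B' F G hA hB
      calc A' * (A * Matrix.transvection (0 : Fin 3) 2 F * B) * B' * Matrix.transvection (0 : Fin 3) 2 G
          = (A' * A) * Matrix.transvection (0 : Fin 3) 2 F * (B * B') * Matrix.transvection (0 : Fin 3) 2 G := by
            simp only [mul_assoc]
        _ = Matrix.transvection (0 : Fin 3) 2 (F + G) := by
            rw [hA, hB, one_mul, mul_one, Matrix.transvection_mul_transvection_same _ _ (by decide)]
    rw [key _ _ _ _ _ _ hinv1 hinv2']
    congr 1
    ring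
  · have hfar : (List.filter (fun l => !decide (0 < l.2.2.1 ∧
          (l.1.val + 1 = l.2.1.val ∨ l.2.1.val + 1 = l.1.val)))
        [((0 : Fin 3), (2 : Fin 3), (-2 : ℝ), some c)]).length = 1 := by
      norm_num [List.filter_cons]
    rw [List.filter_append, List.filter_append, List.filter_append, List.length_append,
      List.length_append, List.length_append, tripleProduct_filter_nil R hR, hfar]
    have e1 := tripleProduct_filter_nil Q₁ hQ₁
    have e2 := tripleProduct_filter_nil Q₂ hQ₂
    simp only [e1] at hex1
    simp only [e2] at hex2
    omega

end Summit.ValiantsHypothesis.ValiantsHypothesis.Cruxes.WordLengthQP.PositiveMonoidExits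

end
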